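import Mathlib
import Summits.NavierStokesRegularity.NavierStokesRegularity.Theorems.HeteroclinicTriggerChainTriggerChainFrontStepTruncDelaySharp
import Summits.NavierStokesRegularity.NavierStokesRegularity.Theorems.TaoLadderRungThreeGappedFrontRobustComparison
import HarnessLib

/-!
# `HeteroclinicTriggerChain` — crux `TriggerChainFrontStep` (item stmt-NavierStokesRegularity-22785):
  the DELAY PHASE of the hop with the SHARP amplification budget — bootstrap and ignition-time law

Sharpening of `…TriggerChainFrontStepTruncPassage` (see `…TruncDelaySharp` for the mechanism): the
amplification budget of the upper trigger over a delay window `[0, T]` is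
`2Λ ≥ 2e′(y(0) + ν)T + e′gh²/e²` (`ν > 0` arbitrary) instead of `Λ ≥ e′(y(0) + gh²/e)T` — only the
INITIAL receiver residue `y(0)` is amplified over the long delay `T ≍ log(h/u(0))/e`; the receiver content
generated during the delay contributes the bounded factor `e^{e′gh²/e²}`. For the chain (`y(0) ≍ β²`,
`u(0) ≍ β`) the budget is `O(1)` for every ignition level `h ≤ 0.35`, uniformly in `β`.
* `heteroclinicTriggerChain_trunc_delayPhase_sharp` — the delay-phase theorem (continuity argument via
  `GappedFrontRobust.bootstrap_family` on the pair `(1 − x, y − (g/e)u²)`), conclusions as in the first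
  version plus the pointwise receiver bound `y ≤ y(0) + g(u² − u(0)²)/e`;
* `heteroclinicTriggerChain_trunc_ignitionTime_sharp` — the ignition-time law with the sharp budget.

HONEST FRAMING: elementary facts about a four-dimensional quadratic ODE (a MODEL truncation of Tao's
lattice, Tao 2016 §4); helper for the crux, no stub credit; nothing here is a statement about the
Navier–Stokes equations; no summit, rung or crux is proved. NS regularity is not proved by this line.
-/

noncomputable section

-- the sub-problem namespace `Summit.NavierStokesRegularity.NavierStokesRegularity` repeats the summit name by design (D-0017)
set_option linter.dupNamespace false

open Real Set

namespace Summit.NavierStokesRegularity.NavierStokesRegularity.Theorems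

/-- Size of the derivative of `y − (g/e)u²` along the truncation when all coordinates have modulus `≤ 1`:
`|(gu² − e′v²) − (g/e)·2u(exu − guy)| ≤ g + e′ + (g/e)·2(e + g)`. [folklore] -/
theorem htcTP_receiverDefect_deriv_bound {e g e' xz uz yz vz : ℝ} (he : 0 < e) (hg : 0 ≤ g)
    (he' : 0 ≤ e') (hu : uz ^ 2 ≤ 1) (hv : vz ^ 2 ≤ 1) (hr : |e * xz - g * yz| ≤ e + g) :
    |(g * uz ^ 2 - e' * vz ^ 2) - g / e * (2 * uz * (e * xz * uz - g * uz * yz))| ≤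
      g + e' + g / e * (2 * (e + g)) := by
  have h3 : 0 ≤ g * uz ^ 2 := mul_nonneg hg (sq_nonneg _)
  have h4 : 0 ≤ e' * vz ^ 2 := mul_nonneg he' (sq_nonneg _)
  have h5 : g * uz ^ 2 ≤ g * 1 := mul_le_mul_of_nonneg_left hu hg
  have h6 : e' * vz ^ 2 ≤ e' * 1 := mul_le_mul_of_nonneg_left hv he'
  have h7 : |g * uz ^ 2 - e' * vz ^ 2| ≤ g + e' := by
    rw [abs_le]; constructor <;> linarith
  have h8 : |2 * uz * (e * xz * uz - g * uz * yz)| ≤ 2 * (e + g) := by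
    have h9 : 2 * uz * (e * xz * uz - g * uz * yz) = 2 * uz ^ 2 * (e * xz - g * yz) := by ring
    rw [h9, abs_mul, abs_of_nonneg (by positivity : (0 : ℝ) ≤ 2 * uz ^ 2)]
    have h11 : 2 * uz ^ 2 ≤ 2 := by linarith
    calc 2 * uz ^ 2 * |e * xz - g * yz| ≤ 2 * |e * xz - g * yz| :=
          mul_le_mul_of_nonneg_right h11 (abs_nonneg _)
      _ ≤ 2 * (e + g) := mul_le_mul_of_nonneg_left hr (by norm_num)
  have h12 : |g / e * (2 * uz * (e * xz * uz - g * uz * yz))| ≤ g / e * (2 * (e + g)) := by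
    rw [abs_mul, abs_of_nonneg (by positivity : (0 : ℝ) ≤ g / e)]
    exact mul_le_mul_of_nonneg_left h8 (by positivity)
  calc |(g * uz ^ 2 - e' * vz ^ 2) - g / e * (2 * uz * (e * xz * uz - g * uz * yz))|
      ≤ |g * uz ^ 2 - e' * vz ^ 2| + |g / e * (2 * uz * (e * xz * uz - g * uz * yz))| := abs_sub _ _
    _ ≤ g + e' + g / e * (2 * (e + g)) := by linarith

/-- Along the truncation the energy `x² + u² + y² + v²` is conserved, so with energy `≤ 1` every
coordinate has square `≤ 1` at all times. [folklore] -/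
theorem htcTP_trunc_sq_le_one (e g e' β : ℝ) (x u y v : ℝ → ℝ)
    (hx : ∀ t, HasDerivAt x (-(e * u t ^ 2) - β * u t * v t) t)
    (hu : ∀ t, HasDerivAt u (e * x t * u t - g * u t * y t) t)
    (hy : ∀ t, HasDerivAt y (g * u t ^ 2 - e' * v t ^ 2) t)
    (hv : ∀ t, HasDerivAt v (β * x t * u t + e' * y t * v t) t)
    (hE : x 0 ^ 2 + u 0 ^ 2 + y 0 ^ 2 + v 0 ^ 2 ≤ 1) (s : ℝ) :
    x s ^ 2 ≤ 1 ∧ u s ^ 2 ≤ 1 ∧ y s ^ 2 ≤ 1 ∧ v s ^ 2 ≤ 1 := by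
  have hEs : x s ^ 2 + u s ^ 2 + y s ^ 2 + v s ^ 2 ≤ 1 := by
    rw [heteroclinicTriggerChain_trunc_energy e g e' β x u y v hx hu hy hv s]; exact hE
  have h1 := sq_nonneg (x s)
  have h2 := sq_nonneg (u s)
  have h3 := sq_nonneg (y s)
  have h4 := sq_nonneg (v s)
  exact ⟨by linarith, by linarith, by linarith, by linarith⟩

/-- Lipschitz bound for the carrier along the truncation (energy `≤ 1`, `e, β ≥ 0`):
`|x(t) − x(s)| ≤ (e + β)|t − s|`. [folklore] -/
theorem htcTP_trunc_lipschitz_carrier (e g e' β : ℝ) (he : 0 ≤ e) (hβ : 0 ≤ β) (x u y v : ℝ → ℝ)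
    (hx : ∀ t, HasDerivAt x (-(e * u t ^ 2) - β * u t * v t) t)
    (hu : ∀ t, HasDerivAt u (e * x t * u t - g * u t * y t) t)
    (hy : ∀ t, HasDerivAt y (g * u t ^ 2 - e' * v t ^ 2) t)
    (hv : ∀ t, HasDerivAt v (β * x t * u t + e' * y t * v t) t)
    (hE : x 0 ^ 2 + u 0 ^ 2 + y 0 ^ 2 + v 0 ^ 2 ≤ 1) (s t : ℝ) :
    |x t - x s| ≤ (e + β) * |t - s| := by
  have hb : ∀ z ∈ (univ : Set ℝ), ‖-(e * u z ^ 2) - β * u z * v z‖ ≤ e + β := by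
    intro z _
    obtain ⟨-, hu2, -, hv2⟩ := htcTP_trunc_sq_le_one e g e' β x u y v hx hu hy hv hE z
    have huv : |u z * v z| ≤ 1 := by
      have h1 : |u z| ≤ 1 := (sq_le_one_iff_abs_le_one (u z)).1 hu2
      have h2 : |v z| ≤ 1 := (sq_le_one_iff_abs_le_one (v z)).1 hv2
      rw [abs_mul]
      nlinarith [abs_nonneg (u z), abs_nonneg (v z)]
    rw [Real.norm_eq_abs, abs_le]
    have h3 : β * (u z * v z) ≤ β * 1 := mul_le_mul_of_nonneg_left ((le_abs_self _).trans huv) hβ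
    have h4 : β * (-(u z * v z)) ≤ β * 1 := mul_le_mul_of_nonneg_left ((neg_le_abs _).trans huv) hβ
    have h5 : 0 ≤ e * u z ^ 2 := mul_nonneg he (sq_nonneg _)
    have h6 : e * u z ^ 2 ≤ e * 1 := mul_le_mul_of_nonneg_left hu2 he
    constructor <;> linarith
  have h := (convex_univ).norm_image_sub_le_of_norm_hasDerivWithin_le
    (fun z _ => (hx z).hasDerivWithinAt) hb (mem_univ s) (mem_univ t)
  rw [Real.norm_eq_abs, Real.norm_eq_abs] at h
  exact h

/-- Lipschitz bound for the receiver defect `y − (g/e)u²` along the truncation (energy `≤ 1`, `e > 0`,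
`g, e′ ≥ 0`): `|U(t) − U(s)| ≤ (g + e′ + (g/e)·2(e + g))|t − s|`. [folklore] -/
theorem htcTP_trunc_lipschitz_receiverDefect (e g e' β : ℝ) (he : 0 < e) (hg : 0 ≤ g) (he' : 0 ≤ e')
    (x u y v : ℝ → ℝ)
    (hx : ∀ t, HasDerivAt x (-(e * u t ^ 2) - β * u t * v t) t)
    (hu : ∀ t, HasDerivAt u (e * x t * u t - g * u t * y t) t)
    (hy : ∀ t, HasDerivAt y (g * u t ^ 2 - e' * v t ^ 2) t)
    (hv : ∀ t, HasDerivAt v (β * x t * u t + e' * y t * v t) t)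
    (hE : x 0 ^ 2 + u 0 ^ 2 + y 0 ^ 2 + v 0 ^ 2 ≤ 1) (s t : ℝ) :
    |(y t - g / e * u t ^ 2) - (y s - g / e * u s ^ 2)| ≤ (g + e' + g / e * (2 * (e + g))) * |t - s| := by
  have hu2d : ∀ s, HasDerivAt (fun q => u q ^ 2) (2 * u s * (e * x s * u s - g * u s * y s)) s := by
    intro s
    have h1 := (hu s).mul (hu s)
    have h2 : (fun q => u q ^ 2) = fun q => u q * u q := funext fun q => sq (u q)
    rw [h2]
    exact h1.congr_deriv (by ring)
  have hUy : ∀ s, HasDerivAt (fun q => y q - g / e * u q ^ 2)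
      ((g * u s ^ 2 - e' * v s ^ 2) - g / e * (2 * u s * (e * x s * u s - g * u s * y s))) s :=
    fun s => (hy s).sub ((hu2d s).const_mul (g / e))
  have hb : ∀ z ∈ (univ : Set ℝ),
      ‖(g * u z ^ 2 - e' * v z ^ 2) - g / e * (2 * u z * (e * x z * u z - g * u z * y z))‖ ≤
        g + e' + g / e * (2 * (e + g)) := by
    intro z _
    obtain ⟨hx2, hu2, hy2, hv2⟩ := htcTP_trunc_sq_le_one e g e' β x u y v hx hu hy hv hE z
    have hrate_abs : |e * x z - g * y z| ≤ e + g := by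
      have h1 : |x z| ≤ 1 := (sq_le_one_iff_abs_le_one (x z)).1 hx2
      have h2 : |y z| ≤ 1 := (sq_le_one_iff_abs_le_one (y z)).1 hy2
      rw [abs_le] at h1 h2 ⊢
      have h3 : e * x z ≤ e * 1 := mul_le_mul_of_nonneg_left h1.2 he.le
      have h4 : e * (-1) ≤ e * x z := mul_le_mul_of_nonneg_left h1.1 he.le
      have h5 : g * y z ≤ g * 1 := mul_le_mul_of_nonneg_left h2.2 hg
      have h6 : g * (-1) ≤ g * y z := mul_le_mul_of_nonneg_left h2.1 hg
      constructor <;> linarith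
    rw [Real.norm_eq_abs]
    exact htcTP_receiverDefect_deriv_bound he hg he' hu2 hv2 hrate_abs
  have h := (convex_univ).norm_image_sub_le_of_norm_hasDerivWithin_le
    (fun z _ => (hUy z).hasDerivWithinAt) hb (mem_univ s) (mem_univ t)
  rw [Real.norm_eq_abs, Real.norm_eq_abs] at h
  exact h

/-- **DELAY PHASE OF THE HOP, SHARP AMPLIFICATION BUDGET** (helper for item stmt-NavierStokesRegularity-22785;
seeded two-shell truncation `x′ = −eu² − βuv`, `u′ = exu − guy`, `y′ = gu² − e′v²`, `v′ = βxu + e′yv`,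
`e, g > 0`, `e′, β ≥ 0`, energy `≤ 1`, `u(0) > 0`, `y(0), v(0) ≥ 0`). On every window `[0, T]` with
`u ≤ h`, for a free `ν > 0` and constants `δ₂ ≥ y(0) + ν + gh²/e`, `2Λ ≥ 2e′(y(0)+ν)T + e′gh²/e²`,
`V ≥ e^{2Λ}(v(0) + 2βh/e)`, `δ₁ ≥ 1 − x(0) + h² + 2βVh/e`, `2δ₁ + 2gδ₂/e ≤ 1/2`,
`4e′e^{4Λ}v(0)² ≤ gu(0)²`, `16e′β²e^{4Λ} ≤ ge²`: throughout the window `1 − δ₁ ≤ x ≤ 1`,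
`y(0) ≤ y ≤ δ₂`, `0 ≤ v ≤ e^{2Λ}(v(0) + 2βu/e)`, `u(0)e^{e(1−ε)s} ≤ u ≤ u(0)e^{es}` (`ε = δ₁ + gδ₂/e`),
`v ≥ v(0) + β(1−δ₁)(u − u(0))/e`, and `y ≤ y(0) + g(u² − u(0)²)/e`. [folklore] -/
theorem heteroclinicTriggerChain_trunc_delayPhase_sharp (e g e' β : ℝ) (he : 0 < e) (hg : 0 < g)
    (he' : 0 ≤ e') (hβ : 0 ≤ β) (x u y v : ℝ → ℝ)
    (hx : ∀ t, HasDerivAt x (-(e * u t ^ 2) - β * u t * v t) t)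
    (hu : ∀ t, HasDerivAt u (e * x t * u t - g * u t * y t) t)
    (hy : ∀ t, HasDerivAt y (g * u t ^ 2 - e' * v t ^ 2) t)
    (hv : ∀ t, HasDerivAt v (β * x t * u t + e' * y t * v t) t)
    (hE : x 0 ^ 2 + u 0 ^ 2 + y 0 ^ 2 + v 0 ^ 2 ≤ 1)
    (hu0 : 0 < u 0) (hy0 : 0 ≤ y 0) (hv0 : 0 ≤ v 0)
    {T h Λ δ₁ δ₂ V ν : ℝ} (hT : 0 ≤ T) (hν : 0 < ν)
    (hδ₂ : y 0 + ν + g * h ^ 2 / e ≤ δ₂) (hΛT : 2 * e' * (y 0 + ν) * T + e' * g * h ^ 2 / e ^ 2 ≤ 2 * Λ)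
    (hV : Real.exp (2 * Λ) * (v 0 + 2 * β * h / e) ≤ V)
    (hδ₁ : 1 - x 0 + h ^ 2 + 2 * β * V * h / e ≤ δ₁)
    (hsmall : 2 * δ₁ + 2 * g * δ₂ / e ≤ 1 / 2)
    (hv0u0 : 4 * e' * Real.exp (4 * Λ) * v 0 ^ 2 ≤ g * u 0 ^ 2)
    (hβe : 16 * e' * β ^ 2 * Real.exp (4 * Λ) ≤ g * e ^ 2)
    (huh : ∀ s ∈ Icc 0 T, u s ≤ h) :
    ∀ s ∈ Icc 0 T,
      1 - δ₁ ≤ x s ∧ x s ≤ 1 ∧ y 0 ≤ y s ∧ y s ≤ δ₂ ∧ 0 < u s ∧ 0 ≤ v s ∧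
      v s ≤ Real.exp (2 * Λ) * (v 0 + 2 * β * u s / e) ∧
      u 0 * Real.exp (e * (1 - (δ₁ + g * δ₂ / e)) * s) ≤ u s ∧ u s ≤ u 0 * Real.exp (e * s) ∧
      v 0 + β * (1 - δ₁) * (u s - u 0) / e ≤ v s ∧
      y s ≤ y 0 + g * (u s ^ 2 - u 0 ^ 2) / e := by
  have h0mem : (0 : ℝ) ∈ Icc 0 T := left_mem_Icc.2 hT
  have hhpos : 0 < h := lt_of_lt_of_le hu0 (huh 0 h0mem)
  have hY₀pos : 0 < y 0 + ν := by linarith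
  have hδ₂pos : 0 < δ₂ := by
    have : 0 < g * h ^ 2 / e := by positivity
    linarith
  -- sizes
  have hx0le : x 0 ≤ 1 := by
    obtain ⟨h1, -, -, -⟩ := htcTP_trunc_sq_le_one e g e' β x u y v hx hu hy hv hE 0
    exact (abs_le.1 ((sq_le_one_iff_abs_le_one _).1 h1)).2
  have hVnn : 0 ≤ V := le_trans (by positivity) hV
  have hδ₁pos : 0 < δ₁ := by
    have h1 : 0 < h ^ 2 := by positivity
    have h2 : 0 ≤ 2 * β * V * h / e := by positivity
    linarith
  -- Lipschitz bounds from the equations of motion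
  have hxlip := htcTP_trunc_lipschitz_carrier e g e' β he.le hβ x u y v hx hu hy hv hE
  have hylip := htcTP_trunc_lipschitz_receiverDefect e g e' β he hg.le he' x u y v hx hu hy hv hE
  have hx0δ : 1 - x 0 ≤ δ₁ := by
    have h1 : 0 ≤ h ^ 2 := sq_nonneg h
    have h2 : 0 ≤ 2 * β * V * h / e := by positivity
    linarith
  have hy0Y : y 0 - g / e * u 0 ^ 2 ≤ y 0 + ν := by
    have h1 : 0 ≤ g / e * u 0 ^ 2 := by positivity
    linarith
  have hδ₂' : y 0 + ν + g * h ^ 2 / e ≤ δ₂ := hδ₂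
  -- the bootstrap on the pair (1 − x, y − (g/e)u²)
  set Ly : ℝ := g + e' + g / e * (2 * (e + g)) with hLy
  have hLynn : 0 ≤ Ly := by positivity
  set L : ℝ := (e + β) / δ₁ + Ly / (y 0 + ν) with hL
  have hLnn : 0 ≤ L := by positivity
  have hLδ₁ : e + β ≤ L * δ₁ := by
    have h1 : L * δ₁ = (e + β) + Ly / (y 0 + ν) * δ₁ := by
      rw [hL]; field_simp
    have h2 : 0 ≤ Ly / (y 0 + ν) * δ₁ := by positivity
    linarith
  have hLY : Ly ≤ L * (y 0 + ν) := by
    have h1 : L * (y 0 + ν) = (e + β) / δ₁ * (y 0 + ν) + Ly := by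
      rw [hL]; field_simp
    have h2 : 0 ≤ (e + β) / δ₁ * (y 0 + ν) := by positivity
    linarith
  have key := GappedFrontRobust.bootstrap_family (ι := Fin 2)
    (u := ![fun s => 1 - x s, fun s => y s - g / e * u s ^ 2]) (p := ![δ₁, y 0 + ν])
    (ψ := fun _ => (1 : ℝ)) (τ := T) (L := L)
    (by intro j; fin_cases j <;> simp <;> linarith) hLnn continuousOn_const (fun _ _ => one_pos)
    (by
      intro j s _ t _
      fin_cases j
      · simp only [Fin.zero_eta, Fin.isValue, Matrix.cons_val_zero]
        have h1 : |1 - x t - (1 - x s)| = |x t - x s| := by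
          rw [show (1 : ℝ) - x t - (1 - x s) = -(x t - x s) by ring, abs_neg]
        rw [h1]
        exact (hxlip s t).trans (mul_le_mul_of_nonneg_right hLδ₁ (abs_nonneg _))
      · simp only [Fin.mk_one, Fin.isValue, Matrix.cons_val_one, Matrix.cons_val_fin_one]
        exact (hylip s t).trans (mul_le_mul_of_nonneg_right hLY (abs_nonneg _)))
    (by intro j; fin_cases j <;> simp <;> linarith)
    (by
      intro t ht hweak j
      have hwx : ∀ s ∈ Icc 0 t, 1 - 2 * δ₁ ≤ x s := fun s hs => by
        have := hweak 0 s hs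
        simp at this
        linarith
      have hwy : ∀ s ∈ Icc 0 t, y s ≤ g / e * u s ^ 2 + 2 * (y 0 + ν) := fun s hs => by
        have := hweak 1 s hs
        simp at this
        linarith
      have hΛt : 2 * e' * (y 0 + ν) * t + e' * g * h ^ 2 / e ^ 2 ≤ 2 * Λ := by
        have := mul_le_mul_of_nonneg_left ht.2 (by positivity : (0 : ℝ) ≤ 2 * e' * (y 0 + ν))
        linarith
      have hc := heteroclinicTriggerChain_trunc_delay_core_sharp e g e' β he hg.le he' hβ x u y v hx hu hy
        hv hE hu0 hy0 hv0 (by linarith : y 0 ≤ y 0 + ν) hδ₂' hΛt hV hδ₁ hsmall hv0u0 hβe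
        (fun s hs => huh s ⟨hs.1, hs.2.trans ht.2⟩) hwx hwy t ⟨ht.1, le_rfl⟩
      fin_cases j
      · simp
        linarith [hc.1]
      · simp
        have h1 := hc.2.2.2.2.2.2.2.2.2.2
        have h2 : g * (u t ^ 2 - u 0 ^ 2) / e = g / e * u t ^ 2 - g / e * u 0 ^ 2 := by ring
        have h3 : 0 ≤ g / e * u 0 ^ 2 := by positivity
        linarith)
  -- strong bounds on the whole window, then the core step once more
  have hsx : ∀ s ∈ Icc 0 T, 1 - 2 * δ₁ ≤ x s := fun s hs => by
    have := key 0 s hs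
    simp at this
    linarith
  have hsy : ∀ s ∈ Icc 0 T, y s ≤ g / e * u s ^ 2 + 2 * (y 0 + ν) := fun s hs => by
    have := key 1 s hs
    simp at this
    linarith
  exact heteroclinicTriggerChain_trunc_delay_core_sharp e g e' β he hg.le he' hβ x u y v hx hu hy hv hE
    hu0 hy0 hv0 (by linarith : y 0 ≤ y 0 + ν) hδ₂' hΛT hV hδ₁ hsmall hv0u0 hβe huh hsx hsy

/-- **IGNITION-TIME LAW, sharp budget** (helper for item stmt-NavierStokesRegularity-22785). In the
setting of `heteroclinicTriggerChain_trunc_delayPhase_sharp`: a window `[0, T]` with `u ≤ h` is no longer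
than `log(h/u(0))/(e(1 − ε))`, `ε = δ₁ + gδ₂/e ≤ 1/4`, and `u(T) = h` forces `T ≥ log(h/u(0))/e`.
[folklore] -/
theorem heteroclinicTriggerChain_trunc_ignitionTime_sharp (e g e' β : ℝ) (he : 0 < e) (hg : 0 < g)
    (he' : 0 ≤ e') (hβ : 0 ≤ β) (x u y v : ℝ → ℝ)
    (hx : ∀ t, HasDerivAt x (-(e * u t ^ 2) - β * u t * v t) t)
    (hu : ∀ t, HasDerivAt u (e * x t * u t - g * u t * y t) t)
    (hy : ∀ t, HasDerivAt y (g * u t ^ 2 - e' * v t ^ 2) t)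
    (hv : ∀ t, HasDerivAt v (β * x t * u t + e' * y t * v t) t)
    (hE : x 0 ^ 2 + u 0 ^ 2 + y 0 ^ 2 + v 0 ^ 2 ≤ 1)
    (hu0 : 0 < u 0) (hy0 : 0 ≤ y 0) (hv0 : 0 ≤ v 0)
    {T h Λ δ₁ δ₂ V ν : ℝ} (hT : 0 ≤ T) (hν : 0 < ν)
    (hδ₂ : y 0 + ν + g * h ^ 2 / e ≤ δ₂) (hΛT : 2 * e' * (y 0 + ν) * T + e' * g * h ^ 2 / e ^ 2 ≤ 2 * Λ)
    (hV : Real.exp (2 * Λ) * (v 0 + 2 * β * h / e) ≤ V)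
    (hδ₁ : 1 - x 0 + h ^ 2 + 2 * β * V * h / e ≤ δ₁)
    (hsmall : 2 * δ₁ + 2 * g * δ₂ / e ≤ 1 / 2)
    (hv0u0 : 4 * e' * Real.exp (4 * Λ) * v 0 ^ 2 ≤ g * u 0 ^ 2)
    (hβe : 16 * e' * β ^ 2 * Real.exp (4 * Λ) ≤ g * e ^ 2)
    (huh : ∀ s ∈ Icc 0 T, u s ≤ h) :
    T ≤ Real.log (h / u 0) / (e * (1 - (δ₁ + g * δ₂ / e))) ∧
      (u T = h → Real.log (h / u 0) / e ≤ T) := by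
  have hTmem : T ∈ Icc 0 T := ⟨hT, le_rfl⟩
  obtain ⟨-, -, -, -, -, -, -, hlow, hup, -, -⟩ :=
    heteroclinicTriggerChain_trunc_delayPhase_sharp e g e' β he hg he' hβ x u y v hx hu hy hv hE hu0 hy0 hv0
      hT hν hδ₂ hΛT hV hδ₁ hsmall hv0u0 hβe huh T hTmem
  have hhpos : 0 < h := lt_of_lt_of_le hu0 (huh 0 (left_mem_Icc.2 hT))
  have hδ₂nn : 0 ≤ δ₂ := by
    have : 0 ≤ g * h ^ 2 / e := by positivity
    linarith
  have hεpos : 0 < 1 - (δ₁ + g * δ₂ / e) := by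
    have h1 : δ₁ + g * δ₂ / e ≤ 1 / 4 := by
      have h2 : 2 * (δ₁ + g * δ₂ / e) = 2 * δ₁ + 2 * g * δ₂ / e := by ring
      linarith
    linarith
  have hrate : 0 < e * (1 - (δ₁ + g * δ₂ / e)) := mul_pos he hεpos
  have hquot : 0 < h / u 0 := div_pos hhpos hu0
  constructor
  · -- u(0) e^{e(1−ε)T} ≤ u(T) ≤ h
    have h1 : Real.exp (e * (1 - (δ₁ + g * δ₂ / e)) * T) ≤ h / u 0 := by
      rw [le_div_iff₀ hu0]
      have := huh T hTmem
      nlinarith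
    have h2 : e * (1 - (δ₁ + g * δ₂ / e)) * T ≤ Real.log (h / u 0) :=
      (Real.le_log_iff_exp_le hquot).2 h1
    rw [le_div_iff₀ hrate]
    linarith
  · intro hTh
    -- h = u(T) ≤ u(0) e^{eT}
    have h1 : h / u 0 ≤ Real.exp (e * T) := by
      rw [div_le_iff₀ hu0]
      nlinarith [hup]
    have h2 : Real.log (h / u 0) ≤ e * T := by
      have := Real.log_le_log hquot h1
      rwa [Real.log_exp] at this
    rw [div_le_iff₀ he]
    linarith

end Summit.NavierStokesRegularity.NavierStokesRegularity.Theorems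

end
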